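import Mathlib
import HarnessLib
import Summits.HubbardSuperconductivity.HubbardSuperconductivity.Theorems.KLProgrammeKLRegimeEnginePairTransferMemberLocalisation
import Summits.HubbardSuperconductivity.HubbardSuperconductivity.Theorems.KLProgrammeKLRegimeEnginePairTransferMemberFlow

/-!
# Route `KLProgramme` — ENGINE child gen 8 (stmt-HubbardSuperconductivity-20437 `KLRegimeEngineV17F2`), skeleton v2 class #5 rev 3 / (E2-F2): the PINNED Riccati defect
# of ONE member RESOLVED BY NAME — `klmd_resolvedRung_sum_eq`, `klmd_pinnedDefect_eq_pinning`, **`klmd_pinnedDefect_eq_resolved`**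
# (cell gate-hubbard-kl, seat hubbard-kl-k3c1-p1 g13, technique «composed-map remainder propagation»; composes MEMBER CHANNEL LAYER 3 + 4 of KLTC-INDEX v8)

WHY.  The class-#5 STEP doors (`pairTransferRelResIdx_family_succ_of_analytic(_split)`, `…Step7AnalyticModel`, rows 24–30 of KLTC-INDEX v9.1) read three SIZES of the
member flows along slice `n+1`: the Riccati-defect sups `ξ₁ ξ₂ ≥ ‖(Ȧᵢ + Aᵢ·diag ḃᵢ·Aᵢ)(t)(x,y)‖` and the DIFFERENCE row `ξΔ ≥ ‖(S_j − S_{j′})(t)(x,y)‖`, all for the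
`ω₀`-PINNED, ball-truncated member arrays `A, Ȧ` of `klmf_memberArray_flowData` with the AGGREGATED rates `ḃ` of `klmf_rung_data`.  The located reading
«(ξΔ)-TRIANGLE» (HOME/STATUS k3c1-p1 g13 05:53Z): `ξΔ` cannot be fed through `klmf_defect_sub_le` (triangle through the ladder `A·diag ḃ·A` — the term
`m²·Σ‖ḃ_j − ḃ_{j′}‖` carries the pair's index mass but NO `2⁻ⁿ` gain, so it is not n-uniformly inside the slice ROOM); the ladder has to be cancelled EXACTLY
in each member first.  This file does that by name, for ONE member `ψ` (even in the frequency) at any frame `K`: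
* `klmd_resolvedRung_sum_eq` — the frequency sum of the RESOLVED rung rate of `klmc_flow_source_eq` is the aggregated rate `ḃ` of `klmf_rung_data`
  (`klmc_sum_resolvedRung_eq_aggRate`, keyed);
* `klmd_pinnedDefect_eq_pinning` — `(Ȧ + A·diag ḃ·A)(t)(x,y) = 𝟙[x,y ∈ ball]·((Γ̇ + Γ·diag ḃ_res·Γ)(t)((x,ω₀),(y,ω₀)) + LOC(t)(x,y))` with `Γ, Γ̇, ḃ_res` the RESOLVED
  curves of `klmc_flow_source_eq` and `LOC` the frequency-localisation sum of `kltc_pinnedDefect_eq`;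
* **`klmd_pinnedDefect_eq_resolved`** — the same with the resolved defect EXPANDED by `klmc_flow_source_eq` into its four non-ladder classes (≥ 2 cross lines `Hd`,
  ph direct, ph crossed, 6–2) at the pinned labels: the pinned defect of a member is, EXACTLY, `𝟙_ball·((Λ_{n+1}−Λₙ)·[−½Hd − (βL²)⁻³(PHd − PHx − 2·S62)] + LOC)`,
  written on ABSTRACT kernels `V V6 Sg Hd Φ Wd Br` pinned to the model by `rfl`-able equations (pass `rfl`).  No ladder term survives; every class is a
  product of explicit one-line weights (`Φ_t = ψ + (w_{Λ_{n+1}} − w_{Λ(t)})`, `Wd_t = ẇ_{Λ(t)}`, `βL²ĝ_K`) with kernels of the member carrier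
  `e^{Δ_{S_ψ + C_{>Λ_{n+1}} − C_{>Λ(t)}}}𝒢^K_{Λ(t)}` — the currency in which the (c) closer / k3c2-p2 two-shell & floor rows are written (ξᵢ), and the
  starting point of the DIFFERENCE door `klmd_defectDiff_le_rows` (ξΔ; companion file).
Exact finite-sum algebra over landed identities; nothing about the model's sizes is asserted; nothing asserts (X).3, (c), K3 or superconductivity.  0 kit · 0 lit.
-/

noncomputable section

namespace Summit.HubbardSuperconductivity.HubbardSuperconductivity.Theorems.KLRegimeSplit

set_option linter.dupNamespace false -- summit = problem name (single-conjunct summit), D-0017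

open Finset Matrix Set Literature.MathematicalPhysics.QuantumLattice Literature.Probability.LatticeModels GrassmannAlgebra
open Summit.HubbardSuperconductivity.HubbardSuperconductivity.Theorems.KLProgrammeLegKernels
open Summit.HubbardSuperconductivity.HubbardSuperconductivity.Theorems.TwoPointAssembly
open Summit.HubbardSuperconductivity.HubbardSuperconductivity.Theorems.DispersionFlow
open Summit.HubbardSuperconductivity.HubbardSuperconductivity.Theorems.KLRegimeWick

variable (L M : ℕ) [NeZero L] [NeZero M] (β U μ : ℝ) (K : TrigPolyC4v)

/-! ## §1 The resolved rung rate aggregates to the door's rate (keyed) -/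

omit [NeZero M] in
/-- **Keyed aggregation**: for a member symbol `ψ` even in the frequency, the frequency sum of the RESOLVED rung rate of `klmc_flow_source_eq` (pair momentum `Qm`,
slice `n+1`, affine time `t`) is the aggregated rate `ḃ(t)(p)` of `klmf_rung_data` (`klmc_sum_resolvedRung_eq_aggRate`). -/
theorem klmd_resolvedRung_sum_eq (hβ : β ≠ 0) (n : ℕ) {ψ : FreqMomentum L M → ℝ} (hψ : ∀ k : FreqMomentum L M, ψ (k.1.rev, k.2) = ψ k)
    (Qm : TorusSite 2 L) (t : ℝ) (p : TorusSite 2 L) :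
    ∑ ν : MatsubaraIdx M, (fun (t : ℝ) (z : TorusSite 2 L × MatsubaraIdx M) => -(((((β * (L : ℝ) ^ 2 : ℝ) : ℂ)))⁻¹ * propCT L M β μ K (z.2, z.1) * propCT L M β μ K (z.2.rev, Qm - z.1))
            * ((((klScale klE0 (n + 1) - klScale klE0 n) * (-deriv (fun Λ' : ℝ => hubbardCutoffWeightCT L M β μ K Λ' (z.2, z.1)) (klScale klE0 n + t * (klScale klE0 (n + 1) - klScale
            klE0 n)) * (ψ (z.2.rev, Qm - z.1) + (hubbardCutoffWeightCT L M β μ K (klScale klE0 (n + 1)) (z.2.rev, Qm - z.1) - hubbardCutoffWeightCT L M β μ K (klScale klE0 n + t *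
            (klScale klE0 (n + 1) - klScale klE0 n)) (z.2.rev, Qm - z.1))) - (ψ (z.2, z.1) + (hubbardCutoffWeightCT L M β μ K (klScale klE0 (n + 1)) (z.2, z.1) - hubbardCutoffWeightCT
            L M β μ K (klScale klE0 n + t * (klScale klE0 (n + 1) - klScale klE0 n)) (z.2, z.1))) * deriv (fun Λ' : ℝ => hubbardCutoffWeightCT L M β μ K Λ' (z.2.rev, Qm - z.1))
            (klScale klE0 n + t * (klScale klE0 (n + 1) - klScale klE0 n)))) : ℝ) : ℂ)) t (p, ν) =
      (fun (t : ℝ) (p : TorusSite 2 L) => (((klScale klE0 (n + 1) - klScale klE0 n) *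
        (klBubbleMass L M β μ K (fun k => deriv (fun Λ' => hubbardCutoffWeightCT L M β μ K Λ' k) (klScale klE0 n + t * (klScale klE0 (n + 1) - klScale klE0 n))) (fun k => ψ k +
                (hubbardCutoffWeightCT L M β μ K (klScale klE0 (n + 1)) k - hubbardCutoffWeightCT L M β μ K (klScale klE0 n + t * (klScale klE0 (n + 1) - klScale klE0 n)) k)) Qm p +
          klBubbleMass L M β μ K (fun k => ψ k + (hubbardCutoffWeightCT L M β μ K (klScale klE0 (n + 1)) k - hubbardCutoffWeightCT L M β μ K (klScale klE0 n + t * (klScale klE0 (n + 1)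
                  - klScale klE0 n)) k)) (fun k => deriv (fun Λ' => hubbardCutoffWeightCT L M β μ K Λ' k) (klScale klE0 n + t * (klScale klE0 (n + 1) - klScale klE0 n))) Qm p) : ℝ) :
                  ℂ)) t p := by
  dsimp only
  exact klmc_sum_resolvedRung_eq_aggRate L M β μ K hβ hψ (klScale klE0 (n + 1)) (klScale klE0 n + t * (klScale klE0 (n + 1) - klScale klE0 n)) (klScale klE0 (n + 1) - klScale klE0 n)
          Qm p

/-! ## §2 Pinning: the door's defect = resolved defect at the pinned labels + localisation -/

/-- **`klmd_pinnedDefect_eq_pinning`**: for the member `ψ` (even in the frequency) along slice `n+1` at pair momentum `Qm`, with `A, Ȧ` the ball arrays of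
`klmf_memberArray_flowData` and `ḃ` the aggregated rate of `klmf_rung_data` (pass `rfl, rfl, rfl`), the PINNED Riccati defect is the RESOLVED one of
`klmc_flow_source_eq` (curves `Γ, Γ̇, ḃ_res` below, literally its `hΓdef/hΓ'def/hb'def` bodies) read at `((x,ω₀),(y,ω₀))` plus the frequency-localisation sum, on the
ball; zero off it (`kltc_pinnedDefect_eq` + `klmd_resolvedRung_sum_eq`). -/
theorem klmd_pinnedDefect_eq_pinning (hβ : β ≠ 0) (n : ℕ) {ψ : FreqMomentum L M → ℝ} (hψ : ∀ k : FreqMomentum L M, ψ (k.1.rev, k.2) = ψ k)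
    (Qm : TorusSite 2 L) (A A' : ℝ → Matrix (TorusSite 2 L) (TorusSite 2 L) ℂ) (b' : ℝ → TorusSite 2 L → ℂ)
    (hAdef : A = fun t => Matrix.of fun k k' : TorusSite 2 L => if k ∈ klBall L μ 0 ∧ k' ∈ klBall L μ 0 then
      vertexFn L M β (gaussConv ℂ (softCovOf L M β μ K ψ + hubbardCovAboveCT L M β μ 0 K (klScale klE0 (n + 1)) - hubbardCovAboveCT L M β μ 0 K (klScale klE0 n + t * (klScale klE0 (n +
              1) - klScale klE0 n))) (hubbardEffectiveActionCT L M β U μ 0 K (klScale klE0 n + t * (klScale klE0 (n + 1) - klScale klE0 n)))) 4 ![(((omega0 M, k'), 0), 0), ((((omega0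
              M).rev, Qm - k'), 1), 0), ((((omega0 M).rev, Qm - k), 1), 1), (((omega0 M, k), 0), 1)]
      else 0)
    (hA'def : A' = fun t => Matrix.of fun k k' : TorusSite 2 L => if k ∈ klBall L μ 0 ∧ k' ∈ klBall L μ 0 then
      (klScale klE0 (n + 1) - klScale klE0 n) • -((2 : ℂ)⁻¹ * vertexFn L M β (gaussConv ℂ (softCovOf L M β μ K ψ + hubbardCovAboveCT L M β μ 0 K (klScale klE0 (n + 1)) -
              hubbardCovAboveCT L M β μ 0 K (klScale klE0 n + t * (klScale klE0 (n + 1) - klScale klE0 n))) (grassmannDerivPairing ℂ (Matrix.of fun X Y : HubbardFieldIdx L M => deriv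
              (fun Λ'' : ℝ => hubbardCovAboveCT L M β μ 0 K Λ'' X Y) (klScale klE0 n + t * (klScale klE0 (n + 1) - klScale klE0 n))) (hubbardEffectiveActionCT L M β U μ 0 K (klScale
              klE0 n + t * (klScale klE0 (n + 1) - klScale klE0 n))) (hubbardEffectiveActionCT L M β U μ 0 K (klScale klE0 n + t * (klScale klE0 (n + 1) - klScale klE0 n))))) 4
              ![(((omega0 M, k'), 0), 0), ((((omega0 M).rev, Qm - k'), 1), 0), ((((omega0 M).rev, Qm - k), 1), 1), (((omega0 M, k), 0), 1)])
      else 0)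
    (hb'def : b' = fun (t : ℝ) (p : TorusSite 2 L) => (((klScale klE0 (n + 1) - klScale klE0 n) *
        (klBubbleMass L M β μ K (fun k => deriv (fun Λ' => hubbardCutoffWeightCT L M β μ K Λ' k) (klScale klE0 n + t * (klScale klE0 (n + 1) - klScale klE0 n))) (fun k => ψ k +
                (hubbardCutoffWeightCT L M β μ K (klScale klE0 (n + 1)) k - hubbardCutoffWeightCT L M β μ K (klScale klE0 n + t * (klScale klE0 (n + 1) - klScale klE0 n)) k)) Qm p +
          klBubbleMass L M β μ K (fun k => ψ k + (hubbardCutoffWeightCT L M β μ K (klScale klE0 (n + 1)) k - hubbardCutoffWeightCT L M β μ K (klScale klE0 n + t * (klScale klE0 (n + 1)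
                  - klScale klE0 n)) k)) (fun k => deriv (fun Λ' => hubbardCutoffWeightCT L M β μ K Λ' k) (klScale klE0 n + t * (klScale klE0 (n + 1) - klScale klE0 n))) Qm p) : ℝ) :
                  ℂ))
    (t : ℝ) (x y : TorusSite 2 L) :
    (A' t + A t * diagonal (b' t) * A t) x y =
      if x ∈ klBall L μ 0 ∧ y ∈ klBall L μ 0 then
        ((fun (t : ℝ) => Matrix.of fun x y : TorusSite 2 L × MatsubaraIdx M => (klScale klE0 (n + 1) - klScale klE0 n) • -((2 : ℂ)⁻¹ * vertexFn L M β (gaussConv ℂ (softCovOf L M β μ K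
                ψ + hubbardCovAboveCT L M β μ 0 K (klScale klE0 (n + 1)) - hubbardCovAboveCT L M β μ 0 K (klScale klE0 n + t * (klScale klE0 (n + 1) - klScale klE0 n)))
                (grassmannDerivPairing ℂ (Matrix.of fun X Y : HubbardFieldIdx L M => deriv (fun Λ'' : ℝ => hubbardCovAboveCT L M β μ 0 K Λ'' X Y) (klScale klE0 n + t * (klScale klE0 (n
                + 1) - klScale klE0 n))) (hubbardEffectiveActionCT L M β U μ 0 K (klScale klE0 n + t * (klScale klE0 (n + 1) - klScale klE0 n))) (hubbardEffectiveActionCT L M β U μ 0 K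
                (klScale klE0 n + t * (klScale klE0 (n + 1) - klScale klE0 n))))) 4 ![(((y.2, y.1), 0), 0), (((y.2.rev, Qm - y.1), 1), 0), (((x.2.rev, Qm - x.1), 1), 1), (((x.2, x.1),
                0), 1)])) t +
            (fun (t : ℝ) => Matrix.of fun x y : TorusSite 2 L × MatsubaraIdx M => vertexFn L M β (gaussConv ℂ (softCovOf L M β μ K ψ + hubbardCovAboveCT L M β μ 0 K (klScale klE0 (n +
                    1)) - hubbardCovAboveCT L M β μ 0 K (klScale klE0 n + t * (klScale klE0 (n + 1) - klScale klE0 n))) (hubbardEffectiveActionCT L M β U μ 0 K (klScale klE0 n + t *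
                    (klScale klE0 (n + 1) - klScale klE0 n)))) 4 ![(((y.2, y.1), 0), 0), (((y.2.rev, Qm - y.1), 1), 0), (((x.2.rev, Qm - x.1), 1), 1), (((x.2, x.1), 0), 1)]) t *
              diagonal ((fun (t : ℝ) (z : TorusSite 2 L × MatsubaraIdx M) => -(((((β * (L : ℝ) ^ 2 : ℝ) : ℂ)))⁻¹ * propCT L M β μ K (z.2, z.1) * propCT L M β μ K (z.2.rev, Qm - z.1)) *
                      ((((klScale klE0 (n + 1) - klScale klE0 n) * (-deriv (fun Λ' : ℝ => hubbardCutoffWeightCT L M β μ K Λ' (z.2, z.1)) (klScale klE0 n + t * (klScale klE0 (n + 1) -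
                      klScale klE0 n)) * (ψ (z.2.rev, Qm - z.1) + (hubbardCutoffWeightCT L M β μ K (klScale klE0 (n + 1)) (z.2.rev, Qm - z.1) - hubbardCutoffWeightCT L M β μ K (klScale
                      klE0 n + t * (klScale klE0 (n + 1) - klScale klE0 n)) (z.2.rev, Qm - z.1))) - (ψ (z.2, z.1) + (hubbardCutoffWeightCT L M β μ K (klScale klE0 (n + 1)) (z.2, z.1) -
                      hubbardCutoffWeightCT L M β μ K (klScale klE0 n + t * (klScale klE0 (n + 1) - klScale klE0 n)) (z.2, z.1))) * deriv (fun Λ' : ℝ => hubbardCutoffWeightCT L M β μ K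
                      Λ' (z.2.rev, Qm - z.1)) (klScale klE0 n + t * (klScale klE0 (n + 1) - klScale klE0 n)))) : ℝ) : ℂ)) t) *
            (fun (t : ℝ) => Matrix.of fun x y : TorusSite 2 L × MatsubaraIdx M => vertexFn L M β (gaussConv ℂ (softCovOf L M β μ K ψ + hubbardCovAboveCT L M β μ 0 K (klScale klE0 (n +
                    1)) - hubbardCovAboveCT L M β μ 0 K (klScale klE0 n + t * (klScale klE0 (n + 1) - klScale klE0 n))) (hubbardEffectiveActionCT L M β U μ 0 K (klScale klE0 n + t *
                    (klScale klE0 (n + 1) - klScale klE0 n)))) 4 ![(((y.2, y.1), 0), 0), (((y.2.rev, Qm - y.1), 1), 0), (((x.2.rev, Qm - x.1), 1), 1), (((x.2, x.1), 0), 1)]) t) (x,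
                    omega0 M) (y, omega0 M) +
          ∑ z : TorusSite 2 L × MatsubaraIdx M, (fun (t : ℝ) (z : TorusSite 2 L × MatsubaraIdx M) => -(((((β * (L : ℝ) ^ 2 : ℝ) : ℂ)))⁻¹ * propCT L M β μ K (z.2, z.1) * propCT L M β μ
                  K (z.2.rev, Qm - z.1)) * ((((klScale klE0 (n + 1) - klScale klE0 n) * (-deriv (fun Λ' : ℝ => hubbardCutoffWeightCT L M β μ K Λ' (z.2, z.1)) (klScale klE0 n + t *
                  (klScale klE0 (n + 1) - klScale klE0 n)) * (ψ (z.2.rev, Qm - z.1) + (hubbardCutoffWeightCT L M β μ K (klScale klE0 (n + 1)) (z.2.rev, Qm - z.1) -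
                  hubbardCutoffWeightCT L M β μ K (klScale klE0 n + t * (klScale klE0 (n + 1) - klScale klE0 n)) (z.2.rev, Qm - z.1))) - (ψ (z.2, z.1) + (hubbardCutoffWeightCT L M β μ
                  K (klScale klE0 (n + 1)) (z.2, z.1) - hubbardCutoffWeightCT L M β μ K (klScale klE0 n + t * (klScale klE0 (n + 1) - klScale klE0 n)) (z.2, z.1))) * deriv (fun Λ' : ℝ
                  => hubbardCutoffWeightCT L M β μ K Λ' (z.2.rev, Qm - z.1)) (klScale klE0 n + t * (klScale klE0 (n + 1) - klScale klE0 n)))) : ℝ) : ℂ)) t z *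
            ((if z.1 ∈ klBall L μ 0 then
                (fun (t : ℝ) => Matrix.of fun x y : TorusSite 2 L × MatsubaraIdx M => vertexFn L M β (gaussConv ℂ (softCovOf L M β μ K ψ + hubbardCovAboveCT L M β μ 0 K (klScale klE0
                        (n + 1)) - hubbardCovAboveCT L M β μ 0 K (klScale klE0 n + t * (klScale klE0 (n + 1) - klScale klE0 n))) (hubbardEffectiveActionCT L M β U μ 0 K (klScale klE0 n
                        + t * (klScale klE0 (n + 1) - klScale klE0 n)))) 4 ![(((y.2, y.1), 0), 0), (((y.2.rev, Qm - y.1), 1), 0), (((x.2.rev, Qm - x.1), 1), 1), (((x.2, x.1), 0), 1)])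
                        t (x, omega0 M) (z.1, omega0 M) * (fun (t : ℝ) => Matrix.of fun x y : TorusSite 2 L × MatsubaraIdx M => vertexFn L M β (gaussConv ℂ (softCovOf L M β μ K ψ +
                        hubbardCovAboveCT L M β μ 0 K (klScale klE0 (n + 1)) - hubbardCovAboveCT L M β μ 0 K (klScale klE0 n + t * (klScale klE0 (n + 1) - klScale klE0 n)))
                        (hubbardEffectiveActionCT L M β U μ 0 K (klScale klE0 n + t * (klScale klE0 (n + 1) - klScale klE0 n)))) 4 ![(((y.2, y.1), 0), 0), (((y.2.rev, Qm - y.1), 1),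
                        0), (((x.2.rev, Qm - x.1), 1), 1), (((x.2, x.1), 0), 1)]) t (z.1, omega0 M) (y, omega0 M)
              else 0) -
              (fun (t : ℝ) => Matrix.of fun x y : TorusSite 2 L × MatsubaraIdx M => vertexFn L M β (gaussConv ℂ (softCovOf L M β μ K ψ + hubbardCovAboveCT L M β μ 0 K (klScale klE0 (n
                      + 1)) - hubbardCovAboveCT L M β μ 0 K (klScale klE0 n + t * (klScale klE0 (n + 1) - klScale klE0 n))) (hubbardEffectiveActionCT L M β U μ 0 K (klScale klE0 n + t
                      * (klScale klE0 (n + 1) - klScale klE0 n)))) 4 ![(((y.2, y.1), 0), 0), (((y.2.rev, Qm - y.1), 1), 0), (((x.2.rev, Qm - x.1), 1), 1), (((x.2, x.1), 0), 1)]) t (x,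
                      omega0 M) z * (fun (t : ℝ) => Matrix.of fun x y : TorusSite 2 L × MatsubaraIdx M => vertexFn L M β (gaussConv ℂ (softCovOf L M β μ K ψ + hubbardCovAboveCT L M β μ
                      0 K (klScale klE0 (n + 1)) - hubbardCovAboveCT L M β μ 0 K (klScale klE0 n + t * (klScale klE0 (n + 1) - klScale klE0 n))) (hubbardEffectiveActionCT L M β U μ 0 K
                      (klScale klE0 n + t * (klScale klE0 (n + 1) - klScale klE0 n)))) 4 ![(((y.2, y.1), 0), 0), (((y.2.rev, Qm - y.1), 1), 0), (((x.2.rev, Qm - x.1), 1), 1), (((x.2,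
                      x.1), 0), 1)]) t z (y, omega0 M))
      else 0 := by
  have hpin := kltc_pinnedDefect_eq ((fun (t : ℝ) => Matrix.of fun x y : TorusSite 2 L × MatsubaraIdx M => vertexFn L M β (gaussConv ℂ (softCovOf L M β μ K ψ + hubbardCovAboveCT L M β
          μ 0 K (klScale klE0 (n + 1)) - hubbardCovAboveCT L M β μ 0 K (klScale klE0 n + t * (klScale klE0 (n + 1) - klScale klE0 n))) (hubbardEffectiveActionCT L M β U μ 0 K (klScale
          klE0 n + t * (klScale klE0 (n + 1) - klScale klE0 n)))) 4 ![(((y.2, y.1), 0), 0), (((y.2.rev, Qm - y.1), 1), 0), (((x.2.rev, Qm - x.1), 1), 1), (((x.2, x.1), 0), 1)]) t)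
          ((fun (t : ℝ) => Matrix.of fun x y : TorusSite 2 L × MatsubaraIdx M => (klScale klE0 (n + 1) - klScale klE0 n) • -((2 : ℂ)⁻¹ * vertexFn L M β (gaussConv ℂ (softCovOf L M β μ
          K ψ + hubbardCovAboveCT L M β μ 0 K (klScale klE0 (n + 1)) - hubbardCovAboveCT L M β μ 0 K (klScale klE0 n + t * (klScale klE0 (n + 1) - klScale klE0 n)))
          (grassmannDerivPairing ℂ (Matrix.of fun X Y : HubbardFieldIdx L M => deriv (fun Λ'' : ℝ => hubbardCovAboveCT L M β μ 0 K Λ'' X Y) (klScale klE0 n + t * (klScale klE0 (n + 1)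
          - klScale klE0 n))) (hubbardEffectiveActionCT L M β U μ 0 K (klScale klE0 n + t * (klScale klE0 (n + 1) - klScale klE0 n))) (hubbardEffectiveActionCT L M β U μ 0 K (klScale
          klE0 n + t * (klScale klE0 (n + 1) - klScale klE0 n))))) 4 ![(((y.2, y.1), 0), 0), (((y.2.rev, Qm - y.1), 1), 0), (((x.2.rev, Qm - x.1), 1), 1), (((x.2, x.1), 0), 1)])) t)
          ((fun (t : ℝ) (z : TorusSite 2 L × MatsubaraIdx M) => -(((((β * (L : ℝ) ^ 2 : ℝ) : ℂ)))⁻¹ * propCT L M β μ K (z.2, z.1) * propCT L M β μ K (z.2.rev, Qm - z.1)) * ((((klScale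
          klE0 (n + 1) - klScale klE0 n) * (-deriv (fun Λ' : ℝ => hubbardCutoffWeightCT L M β μ K Λ' (z.2, z.1)) (klScale klE0 n + t * (klScale klE0 (n + 1) - klScale klE0 n)) * (ψ
          (z.2.rev, Qm - z.1) + (hubbardCutoffWeightCT L M β μ K (klScale klE0 (n + 1)) (z.2.rev, Qm - z.1) - hubbardCutoffWeightCT L M β μ K (klScale klE0 n + t * (klScale klE0 (n +
          1) - klScale klE0 n)) (z.2.rev, Qm - z.1))) - (ψ (z.2, z.1) + (hubbardCutoffWeightCT L M β μ K (klScale klE0 (n + 1)) (z.2, z.1) - hubbardCutoffWeightCT L M β μ K (klScale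
          klE0 n + t * (klScale klE0 (n + 1) - klScale klE0 n)) (z.2, z.1))) * deriv (fun Λ' : ℝ => hubbardCutoffWeightCT L M β μ K Λ' (z.2.rev, Qm - z.1)) (klScale klE0 n + t *
          (klScale klE0 (n + 1) - klScale klE0 n)))) : ℝ) : ℂ)) t) (omega0 M) (klBall L μ 0) x y
  have hA : A t = Matrix.of fun k k' : TorusSite 2 L => if k ∈ klBall L μ 0 ∧ k' ∈ klBall L μ 0 then
      (fun (t : ℝ) => Matrix.of fun x y : TorusSite 2 L × MatsubaraIdx M => vertexFn L M β (gaussConv ℂ (softCovOf L M β μ K ψ + hubbardCovAboveCT L M β μ 0 K (klScale klE0 (n + 1)) -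
              hubbardCovAboveCT L M β μ 0 K (klScale klE0 n + t * (klScale klE0 (n + 1) - klScale klE0 n))) (hubbardEffectiveActionCT L M β U μ 0 K (klScale klE0 n + t * (klScale klE0
              (n + 1) - klScale klE0 n)))) 4 ![(((y.2, y.1), 0), 0), (((y.2.rev, Qm - y.1), 1), 0), (((x.2.rev, Qm - x.1), 1), 1), (((x.2, x.1), 0), 1)]) t (k, omega0 M) (k', omega0 M)
              else 0 := by
    subst hAdef; rfl
  have hA' : A' t = Matrix.of fun k k' : TorusSite 2 L => if k ∈ klBall L μ 0 ∧ k' ∈ klBall L μ 0 then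
      (fun (t : ℝ) => Matrix.of fun x y : TorusSite 2 L × MatsubaraIdx M => (klScale klE0 (n + 1) - klScale klE0 n) • -((2 : ℂ)⁻¹ * vertexFn L M β (gaussConv ℂ (softCovOf L M β μ K ψ +
              hubbardCovAboveCT L M β μ 0 K (klScale klE0 (n + 1)) - hubbardCovAboveCT L M β μ 0 K (klScale klE0 n + t * (klScale klE0 (n + 1) - klScale klE0 n)))
              (grassmannDerivPairing ℂ (Matrix.of fun X Y : HubbardFieldIdx L M => deriv (fun Λ'' : ℝ => hubbardCovAboveCT L M β μ 0 K Λ'' X Y) (klScale klE0 n + t * (klScale klE0 (n +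
              1) - klScale klE0 n))) (hubbardEffectiveActionCT L M β U μ 0 K (klScale klE0 n + t * (klScale klE0 (n + 1) - klScale klE0 n))) (hubbardEffectiveActionCT L M β U μ 0 K
              (klScale klE0 n + t * (klScale klE0 (n + 1) - klScale klE0 n))))) 4 ![(((y.2, y.1), 0), 0), (((y.2.rev, Qm - y.1), 1), 0), (((x.2.rev, Qm - x.1), 1), 1), (((x.2, x.1),
              0), 1)])) t (k, omega0 M) (k', omega0 M) else 0 := by
    subst hA'def; rfl
  have hb : diagonal (b' t) = diagonal (fun p : TorusSite 2 L => ∑ ν : MatsubaraIdx M, (fun (t : ℝ) (z : TorusSite 2 L × MatsubaraIdx M) => -(((((β * (L : ℝ) ^ 2 : ℝ) : ℂ)))⁻¹ * propCT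
          L M β μ K (z.2, z.1) * propCT L M β μ K (z.2.rev, Qm - z.1)) * ((((klScale klE0 (n + 1) - klScale klE0 n) * (-deriv (fun Λ' : ℝ => hubbardCutoffWeightCT L M β μ K Λ' (z.2,
          z.1)) (klScale klE0 n + t * (klScale klE0 (n + 1) - klScale klE0 n)) * (ψ (z.2.rev, Qm - z.1) + (hubbardCutoffWeightCT L M β μ K (klScale klE0 (n + 1)) (z.2.rev, Qm - z.1) -
          hubbardCutoffWeightCT L M β μ K (klScale klE0 n + t * (klScale klE0 (n + 1) - klScale klE0 n)) (z.2.rev, Qm - z.1))) - (ψ (z.2, z.1) + (hubbardCutoffWeightCT L M β μ K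
          (klScale klE0 (n + 1)) (z.2, z.1) - hubbardCutoffWeightCT L M β μ K (klScale klE0 n + t * (klScale klE0 (n + 1) - klScale klE0 n)) (z.2, z.1))) * deriv (fun Λ' : ℝ =>
          hubbardCutoffWeightCT L M β μ K Λ' (z.2.rev, Qm - z.1)) (klScale klE0 n + t * (klScale klE0 (n + 1) - klScale klE0 n)))) : ℝ) : ℂ)) t (p, ν)) := by
    congr 1
    funext p
    rw [klmd_resolvedRung_sum_eq L M β μ K hβ n hψ Qm t p, hb'def]
  rw [hA, hA', hb, hpin]

/-! ## §3 The pinned defect resolved into the four non-ladder classes + localisation -/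

set_option maxHeartbeats 1600000 in -- the instantiated `klmc_flow_source_eq` identity is a very large term; plumbing only
/-- **`klmd_pinnedDefect_eq_resolved`** — THE MEMBER'S PINNED RICCATI DEFECT BY NAME.  Member `ψ` (even in the frequency), frame `K`, `β ≠ 0`, slice `n+1` with the
affine cutoff `Λ(t) = Λₙ + t(Λ_{n+1} − Λₙ)`, pair momentum `Qm`; `A, Ȧ, ḃ` the door's curves (`klmf_memberArray_flowData`, `klmf_rung_data`; pass `rfl ×3`); abstract
kernels pinned by `rfl` (pass `rfl ×7`): `V t X = 𝒱₄(𝓜_t)(X)`, `V6 t X = 𝒱₆(𝓜_t)(X)`, `Sg t p σ = Σ(𝓜_t)(p,σ)` for the member carrier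
`𝓜_t = e^{Δ_{S_ψ + C_{>Λ_{n+1}} − C_{>Λ(t)}}}𝒢^K_{Λ(t)}`, `Hd t X` = the «≥ 2 cross lines» class of `klmc_flow_source_eq`, `Φ t = ψ + (w_{Λ_{n+1}} − w_{Λ(t)})`
(running symbol), `Wd t = ẇ_{Λ(t)}`, `Br t (p,ν)` = the resolved rung rate.  THEN for `t ∈ [0,1]` and all `x y`:
`(Ȧ + A·diag ḃ·A)(t)(x,y) = 𝟙[x,y ∈ ball]·((Λ_{n+1}−Λₙ)·[−½·Hd − (βL²)⁻³·(PHd − PHx − 2·S62)]((x,ω₀),(y,ω₀)) + LOC(t)(x,y))` with the classes written out below —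
no ladder term. -/
theorem klmd_pinnedDefect_eq_resolved (hβ : β ≠ 0) (n : ℕ) {ψ : FreqMomentum L M → ℝ} (hψ : ∀ k : FreqMomentum L M, ψ (k.1.rev, k.2) = ψ k)
    (Qm : TorusSite 2 L) (A A' : ℝ → Matrix (TorusSite 2 L) (TorusSite 2 L) ℂ) (b' : ℝ → TorusSite 2 L → ℂ)
    (hAdef : A = fun t => Matrix.of fun k k' : TorusSite 2 L => if k ∈ klBall L μ 0 ∧ k' ∈ klBall L μ 0 then
      vertexFn L M β (gaussConv ℂ (softCovOf L M β μ K ψ + hubbardCovAboveCT L M β μ 0 K (klScale klE0 (n + 1)) - hubbardCovAboveCT L M β μ 0 K (klScale klE0 n + t * (klScale klE0 (n +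
              1) - klScale klE0 n))) (hubbardEffectiveActionCT L M β U μ 0 K (klScale klE0 n + t * (klScale klE0 (n + 1) - klScale klE0 n)))) 4 ![(((omega0 M, k'), 0), 0), ((((omega0
              M).rev, Qm - k'), 1), 0), ((((omega0 M).rev, Qm - k), 1), 1), (((omega0 M, k), 0), 1)]
      else 0)
    (hA'def : A' = fun t => Matrix.of fun k k' : TorusSite 2 L => if k ∈ klBall L μ 0 ∧ k' ∈ klBall L μ 0 then
      (klScale klE0 (n + 1) - klScale klE0 n) • -((2 : ℂ)⁻¹ * vertexFn L M β (gaussConv ℂ (softCovOf L M β μ K ψ + hubbardCovAboveCT L M β μ 0 K (klScale klE0 (n + 1)) -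
              hubbardCovAboveCT L M β μ 0 K (klScale klE0 n + t * (klScale klE0 (n + 1) - klScale klE0 n))) (grassmannDerivPairing ℂ (Matrix.of fun X Y : HubbardFieldIdx L M => deriv
              (fun Λ'' : ℝ => hubbardCovAboveCT L M β μ 0 K Λ'' X Y) (klScale klE0 n + t * (klScale klE0 (n + 1) - klScale klE0 n))) (hubbardEffectiveActionCT L M β U μ 0 K (klScale
              klE0 n + t * (klScale klE0 (n + 1) - klScale klE0 n))) (hubbardEffectiveActionCT L M β U μ 0 K (klScale klE0 n + t * (klScale klE0 (n + 1) - klScale klE0 n))))) 4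
              ![(((omega0 M, k'), 0), 0), ((((omega0 M).rev, Qm - k'), 1), 0), ((((omega0 M).rev, Qm - k), 1), 1), (((omega0 M, k), 0), 1)])
      else 0)
    (hb'def : b' = fun (t : ℝ) (p : TorusSite 2 L) => (((klScale klE0 (n + 1) - klScale klE0 n) *
        (klBubbleMass L M β μ K (fun k => deriv (fun Λ' => hubbardCutoffWeightCT L M β μ K Λ' k) (klScale klE0 n + t * (klScale klE0 (n + 1) - klScale klE0 n))) (fun k => ψ k +
                (hubbardCutoffWeightCT L M β μ K (klScale klE0 (n + 1)) k - hubbardCutoffWeightCT L M β μ K (klScale klE0 n + t * (klScale klE0 (n + 1) - klScale klE0 n)) k)) Qm p +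
          klBubbleMass L M β μ K (fun k => ψ k + (hubbardCutoffWeightCT L M β μ K (klScale klE0 (n + 1)) k - hubbardCutoffWeightCT L M β μ K (klScale klE0 n + t * (klScale klE0 (n + 1)
                  - klScale klE0 n)) k)) (fun k => deriv (fun Λ' => hubbardCutoffWeightCT L M β μ K Λ' k) (klScale klE0 n + t * (klScale klE0 (n + 1) - klScale klE0 n))) Qm p) : ℝ) :
                  ℂ))
    (V : ℝ → (Fin 4 → HubbardFieldIdx L M) → ℂ) (hV : V = fun t X => vertexFn L M β (gaussConv ℂ (softCovOf L M β μ K ψ + hubbardCovAboveCT L M β μ 0 K (klScale klE0 (n + 1)) -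
            hubbardCovAboveCT L M β μ 0 K (klScale klE0 n + t * (klScale klE0 (n + 1) - klScale klE0 n))) (hubbardEffectiveActionCT L M β U μ 0 K (klScale klE0 n + t * (klScale klE0 (n
            + 1) - klScale klE0 n)))) 4 X)
    (V6 : ℝ → (Fin 6 → HubbardFieldIdx L M) → ℂ) (hV6 : V6 = fun t X => vertexFn L M β (gaussConv ℂ (softCovOf L M β μ K ψ + hubbardCovAboveCT L M β μ 0 K (klScale klE0 (n + 1)) -
            hubbardCovAboveCT L M β μ 0 K (klScale klE0 n + t * (klScale klE0 (n + 1) - klScale klE0 n))) (hubbardEffectiveActionCT L M β U μ 0 K (klScale klE0 n + t * (klScale klE0 (n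
            + 1) - klScale klE0 n)))) 6 X)
    (Sg : ℝ → FreqMomentum L M → Fin 2 → ℂ) (hSg : Sg = fun t p σ => selfEnergy L M β (gaussConv ℂ (softCovOf L M β μ K ψ + hubbardCovAboveCT L M β μ 0 K (klScale klE0 (n + 1)) -
            hubbardCovAboveCT L M β μ 0 K (klScale klE0 n + t * (klScale klE0 (n + 1) - klScale klE0 n))) (hubbardEffectiveActionCT L M β U μ 0 K (klScale klE0 n + t * (klScale klE0 (n
            + 1) - klScale klE0 n)))) p σ)
    (Hd : ℝ → (Fin 4 → HubbardFieldIdx L M) → ℂ) (hHd : Hd = fun t X => vertexFn L M β (dblFold ℂ (grassmannLaplacian ℂ (crossCov ℂ (Matrix.of fun X Y : HubbardFieldIdx L M => deriv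
            (fun Λ' : ℝ => hubbardCovAboveCT L M β μ 0 K Λ' X Y) (klScale klE0 n + t * (klScale klE0 (n + 1) - klScale klE0 n)))) ((gaussConv ℂ (crossCov ℂ (softCovOf L M β μ K ψ +
            hubbardCovAboveCT L M β μ 0 K (klScale klE0 (n + 1)) - hubbardCovAboveCT L M β μ 0 K (klScale klE0 n + t * (klScale klE0 (n + 1) - klScale klE0 n)))) - grassmannLaplacian ℂ
            (crossCov ℂ (softCovOf L M β μ K ψ + hubbardCovAboveCT L M β μ 0 K (klScale klE0 (n + 1)) - hubbardCovAboveCT L M β μ 0 K (klScale klE0 n + t * (klScale klE0 (n + 1) -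
            klScale klE0 n))))) (dblCopy ℂ 0 (gaussConv ℂ (softCovOf L M β μ K ψ + hubbardCovAboveCT L M β μ 0 K (klScale klE0 (n + 1)) - hubbardCovAboveCT L M β μ 0 K (klScale klE0 n
            + t * (klScale klE0 (n + 1) - klScale klE0 n))) (hubbardEffectiveActionCT L M β U μ 0 K (klScale klE0 n + t * (klScale klE0 (n + 1) - klScale klE0 n)))) * dblCopy ℂ 1
            (gaussConv ℂ (softCovOf L M β μ K ψ + hubbardCovAboveCT L M β μ 0 K (klScale klE0 (n + 1)) - hubbardCovAboveCT L M β μ 0 K (klScale klE0 n + t * (klScale klE0 (n + 1) -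
            klScale klE0 n))) (hubbardEffectiveActionCT L M β U μ 0 K (klScale klE0 n + t * (klScale klE0 (n + 1) - klScale klE0 n)))))))) 4 X)
    (Φ : ℝ → FreqMomentum L M → ℝ) (hΦ : Φ = fun t k => ψ k + (hubbardCutoffWeightCT L M β μ K (klScale klE0 (n + 1)) k - hubbardCutoffWeightCT L M β μ K (klScale klE0 n + t * (klScale
            klE0 (n + 1) - klScale klE0 n)) k))
    (Wd : ℝ → FreqMomentum L M → ℝ) (hWd : Wd = fun t k => deriv (fun Λ' : ℝ => hubbardCutoffWeightCT L M β μ K Λ' k) (klScale klE0 n + t * (klScale klE0 (n + 1) - klScale klE0 n)))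
    (Br : ℝ → TorusSite 2 L × MatsubaraIdx M → ℂ) (hBr : Br = fun t z => -(((((β * (L : ℝ) ^ 2 : ℝ) : ℂ)))⁻¹ * propCT L M β μ K (z.2, z.1) * propCT L M β μ K (z.2.rev, Qm - z.1)) *
      ((((klScale klE0 (n + 1) - klScale klE0 n) * (-Wd t (z.2, z.1) * Φ t (z.2.rev, Qm - z.1) - Φ t (z.2, z.1) * Wd t (z.2.rev, Qm - z.1))) : ℝ) : ℂ))
    {t : ℝ} (ht : t ∈ Icc (0 : ℝ) 1) (x y : TorusSite 2 L) :
    (A' t + A t * diagonal (b' t) * A t) x y =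
      if x ∈ klBall L μ 0 ∧ y ∈ klBall L μ 0 then
        ((((klScale klE0 (n + 1) - klScale klE0 n)) : ℝ) : ℂ) *
          (-((2 : ℂ)⁻¹ * Hd t ![(((omega0 M, y), 0), 0), ((((omega0 M).rev, Qm - y), 1), 0), ((((omega0 M).rev, Qm - x), 1), 1), (((omega0 M, x), 0), 1)]) -
            ((((β * (L : ℝ) ^ 2 : ℝ) : ℂ)) ^ 3)⁻¹ *
              ((∑ p : FreqMomentum L M, ∑ σ : Fin 2, ∑ p' : FreqMomentum L M,
            if matsubaraInt M p'.1 + matsubaraInt M (omega0 M) = matsubaraInt M p.1 + matsubaraInt M (omega0 M) ∧ p'.2 = p.2 + x - y then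
              ((((((Φ t p) : ℝ) : ℂ) * (((β * (L : ℝ) ^ 2 : ℝ) : ℂ) * propCT L M β μ K p)) * ((((Wd t p') : ℝ) : ℂ) * (((β * (L : ℝ) ^ 2 : ℝ) : ℂ) * propCT L M β μ K p'))) + (((((Wd t
                      p) : ℝ) : ℂ) * (((β * (L : ℝ) ^ 2 : ℝ) : ℂ) * propCT L M β μ K p)) * ((((Φ t p') : ℝ) : ℂ) * (((β * (L : ℝ) ^ 2 : ℝ) : ℂ) * propCT L M β μ K p')))) *
                (V t ![((p, σ), 1), ((p', σ), 0), (((omega0 M, y), 0), 0), (((omega0 M, x), 0), 1)] *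
                  V t ![((p, σ), 0), ((p', σ), 1), ((((omega0 M).rev, Qm - y), 1), 0), ((((omega0 M).rev, Qm - x), 1), 1)])
            else 0) -
                (∑ p : FreqMomentum L M, ∑ p' : FreqMomentum L M,
            if matsubaraInt M p'.1 + matsubaraInt M (omega0 M) + matsubaraInt M (omega0 M) + 1 = matsubaraInt M p.1 ∧ p'.2 = p.2 + Qm - x - y then
              ((((((Φ t p) : ℝ) : ℂ) * (((β * (L : ℝ) ^ 2 : ℝ) : ℂ) * propCT L M β μ K p)) * ((((Wd t p') : ℝ) : ℂ) * (((β * (L : ℝ) ^ 2 : ℝ) : ℂ) * propCT L M β μ K p'))) + (((((Wd t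
                      p) : ℝ) : ℂ) * (((β * (L : ℝ) ^ 2 : ℝ) : ℂ) * propCT L M β μ K p)) * ((((Φ t p') : ℝ) : ℂ) * (((β * (L : ℝ) ^ 2 : ℝ) : ℂ) * propCT L M β μ K p')))) *
                (V t ![((p, 0), 1), ((p', 1), 0), (((omega0 M, y), 0), 0), ((((omega0 M).rev, Qm - x), 1), 1)] *
                  V t ![((p, 0), 0), ((p', 1), 1), ((((omega0 M).rev, Qm - y), 1), 0), (((omega0 M, x), 0), 1)])
            else 0) -
                2 * (∑ p : FreqMomentum L M, ∑ σ : Fin 2,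
            (((((Wd t p) : ℝ) : ℂ) * (((β * (L : ℝ) ^ 2 : ℝ) : ℂ) * propCT L M β μ K p)) * ((((Φ t p) : ℝ) : ℂ) * (((β * (L : ℝ) ^ 2 : ℝ) : ℂ) * propCT L M β μ K p))) *
              (V6 t ![((p, σ), 0), ((p, σ), 1), (((omega0 M, y), 0), 0), ((((omega0 M).rev, Qm - y), 1), 0), ((((omega0 M).rev, Qm - x), 1), 1),
                (((omega0 M, x), 0), 1)] *
                Sg t p σ)))) +
        ∑ z : TorusSite 2 L × MatsubaraIdx M, Br t z *
          ((if z.1 ∈ klBall L μ 0 then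
              V t ![(((omega0 M, z.1), 0), 0), ((((omega0 M).rev, Qm - z.1), 1), 0), ((((omega0 M).rev, Qm - x), 1), 1), (((omega0 M, x), 0), 1)] *
                V t ![(((omega0 M, y), 0), 0), ((((omega0 M).rev, Qm - y), 1), 0), ((((omega0 M).rev, Qm - z.1), 1), 1), (((omega0 M, z.1), 0), 1)]
            else 0) -
            V t ![(((z.2, z.1), 0), 0), (((z.2.rev, Qm - z.1), 1), 0), ((((omega0 M).rev, Qm - x), 1), 1), (((omega0 M, x), 0), 1)] *
              V t ![(((omega0 M, y), 0), 0), ((((omega0 M).rev, Qm - y), 1), 0), (((z.2.rev, Qm - z.1), 1), 1), (((z.2, z.1), 0), 1)])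
      else 0 := by
  have h10 : klScale klE0 (n + 1) ≤ klScale klE0 n := (klmf_klScale_succ_pos_le n).2
  have h1 : 0 < klScale klE0 (n + 1) := (klmf_klScale_succ_pos_le n).1
  -- (1) pinning
  rw [klmd_pinnedDefect_eq_pinning L M β U μ K hβ n hψ Qm A A' b' hAdef hA'def hb'def t x y]
  -- (2) the resolved defect of this member (klmc_flow_source_eq, conjunct 3)
  obtain ⟨-, -, hsrc⟩ := klmc_flow_source_eq L M β U μ K hβ h10 h1 ψ Qm (fun (t : ℝ) => Matrix.of fun x y : TorusSite 2 L × MatsubaraIdx M => vertexFn L M β (gaussConv ℂ (softCovOf L M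
          β μ K ψ + hubbardCovAboveCT L M β μ 0 K (klScale klE0 (n + 1)) - hubbardCovAboveCT L M β μ 0 K (klScale klE0 n + t * (klScale klE0 (n + 1) - klScale klE0 n)))
          (hubbardEffectiveActionCT L M β U μ 0 K (klScale klE0 n + t * (klScale klE0 (n + 1) - klScale klE0 n)))) 4 ![(((y.2, y.1), 0), 0), (((y.2.rev, Qm - y.1), 1), 0), (((x.2.rev,
          Qm - x.1), 1), 1), (((x.2, x.1), 0), 1)]) (fun (t : ℝ) => Matrix.of fun x y : TorusSite 2 L × MatsubaraIdx M => (klScale klE0 (n + 1) - klScale klE0 n) • -((2 : ℂ)⁻¹ *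
          vertexFn L M β (gaussConv ℂ (softCovOf L M β μ K ψ + hubbardCovAboveCT L M β μ 0 K (klScale klE0 (n + 1)) - hubbardCovAboveCT L M β μ 0 K (klScale klE0 n + t * (klScale klE0
          (n + 1) - klScale klE0 n))) (grassmannDerivPairing ℂ (Matrix.of fun X Y : HubbardFieldIdx L M => deriv (fun Λ'' : ℝ => hubbardCovAboveCT L M β μ 0 K Λ'' X Y) (klScale klE0 n
          + t * (klScale klE0 (n + 1) - klScale klE0 n))) (hubbardEffectiveActionCT L M β U μ 0 K (klScale klE0 n + t * (klScale klE0 (n + 1) - klScale klE0 n)))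
          (hubbardEffectiveActionCT L M β U μ 0 K (klScale klE0 n + t * (klScale klE0 (n + 1) - klScale klE0 n))))) 4 ![(((y.2, y.1), 0), 0), (((y.2.rev, Qm - y.1), 1), 0), (((x.2.rev,
          Qm - x.1), 1), 1), (((x.2, x.1), 0), 1)]))
    (fun (t : ℝ) (z : TorusSite 2 L × MatsubaraIdx M) => -(((((β * (L : ℝ) ^ 2 : ℝ) : ℂ)))⁻¹ * propCT L M β μ K (z.2, z.1) * propCT L M β μ K (z.2.rev, Qm - z.1)) * ((((ψ (z.2, z.1) +
            (hubbardCutoffWeightCT L M β μ K (klScale klE0 (n + 1)) (z.2, z.1) - hubbardCutoffWeightCT L M β μ K (klScale klE0 n + t * (klScale klE0 (n + 1) - klScale klE0 n)) (z.2,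
            z.1))) * (ψ (z.2.rev, Qm - z.1) + (hubbardCutoffWeightCT L M β μ K (klScale klE0 (n + 1)) (z.2.rev, Qm - z.1) - hubbardCutoffWeightCT L M β μ K (klScale klE0 n + t *
            (klScale klE0 (n + 1) - klScale klE0 n)) (z.2.rev, Qm - z.1)))) : ℝ) : ℂ)) (fun (t : ℝ) (z : TorusSite 2 L × MatsubaraIdx M) => -(((((β * (L : ℝ) ^ 2 : ℝ) : ℂ)))⁻¹ * propCT
            L M β μ K (z.2, z.1) * propCT L M β μ K (z.2.rev, Qm - z.1)) * ((((klScale klE0 (n + 1) - klScale klE0 n) * (-deriv (fun Λ' : ℝ => hubbardCutoffWeightCT L M β μ K Λ' (z.2,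
            z.1)) (klScale klE0 n + t * (klScale klE0 (n + 1) - klScale klE0 n)) * (ψ (z.2.rev, Qm - z.1) + (hubbardCutoffWeightCT L M β μ K (klScale klE0 (n + 1)) (z.2.rev, Qm - z.1)
            - hubbardCutoffWeightCT L M β μ K (klScale klE0 n + t * (klScale klE0 (n + 1) - klScale klE0 n)) (z.2.rev, Qm - z.1))) - (ψ (z.2, z.1) + (hubbardCutoffWeightCT L M β μ K
            (klScale klE0 (n + 1)) (z.2, z.1) - hubbardCutoffWeightCT L M β μ K (klScale klE0 n + t * (klScale klE0 (n + 1) - klScale klE0 n)) (z.2, z.1))) * deriv (fun Λ' : ℝ =>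
            hubbardCutoffWeightCT L M β μ K Λ' (z.2.rev, Qm - z.1)) (klScale klE0 n + t * (klScale klE0 (n + 1) - klScale klE0 n)))) : ℝ) : ℂ)) rfl rfl rfl rfl
  subst hV hV6 hSg hHd hΦ hWd hBr
  by_cases hxy : x ∈ klBall L μ 0 ∧ y ∈ klBall L μ 0
  · rw [if_pos hxy, if_pos hxy, hsrc t ht (x, omega0 M) (y, omega0 M)]
    rfl
  · rw [if_neg hxy, if_neg hxy]

end Summit.HubbardSuperconductivity.HubbardSuperconductivity.Theorems.KLRegimeSplit

end
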